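import Literature.Topology.FourManifolds.BasinPairConj
import Literature.Topology.FourManifolds.BasinLevelPoints
import HarnessLib

/-!
# Level transports between the two flows of a pair of basin settings

Topic `Literature/Topology/FourManifolds` (support file for the two-field handle-extension
endgame of `stmt-SmoothPoincare4-15190`, after `BasinPairConj.lean`).  Everything here is
**proved**; the one new structure is bookkeeping.

Milnor, *Lectures on the h-cobordism theorem* (1965), Thm. 4.1 (PDF p. 22) and the proof of
Thm. 5.4, Assertion 4 (PDF p. 29): points are moved *along the trajectories* of a gradient-like
field to a prescribed level, smoothly (implicit function theorem for the hitting time).  For a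
pair of basin settings `P : Literature.Topology.FourManifolds.BasinPair g ξ_A ξ_B` we abstract
the device used by `BasinPairConj.conj` (reference level `L`, reference map the transport of a
boundary map): given **reference data** `R : P.RefData` — a reference level `ℓ₀`, an open set
`U` cutting out a piece `U ∩ g⁻¹(ℓ₀)` of that level, an open set `I₀` of served levels and a
reference map `Φ` sending that piece into the level `ℓ₀` along whose images the `ξ_B`-flow
sweeps all the levels of `I₀` — the **level transport**

* `RefData.LT R x = levelProj θ_B g (g x) (Φ (levelProj θ_A g ℓ₀ x))` on the open set
  `RefData.dom R` (levels in `I₀`, non-critical, the `ξ_A`-trajectory meets the level `ℓ₀` inside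
  `U`):

it preserves `g` (`apply_LT`), is smooth (`contMDiffAt_LT`, joint smoothness of level points,
`SlabHittingTime.lean`), is **equivariant along the trajectories** (`LT_levelProj`), two
reference data give **the same transport wherever their reference images lie on a common
`ξ_B`-trajectory** (`LT_eq_LT_of_exists_θ`) — the form in which the pieces of the extension
map are compared — and reference data for `P.swap` inverting `Φ` invert `LT` (`LT_LT_of_inverse`).
The `W`-typed bookkeeping of level points along non-critical trajectories of one basin setting
is in `BasinLevelPoints.lean`.

## References

* J. Milnor, *Lectures on the h-cobordism theorem* (1965), Thm. 4.1 (PDF p. 22), proof of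
  Thm. 5.4, Assertion 4 (PDF p. 29). [MilnorHCobordism1965]
* H. B. Griffiths, *Automorphisms of a 3-dimensional handlebody*, Abh. Math. Sem. Univ. Hamburg
  26 (1964), §§3–6. [GriffithsHB1964Handlebody]
-/

open scoped Manifold ContDiff Topology
open Set Function Filter Metric

noncomputable section

namespace Literature.Topology.FourManifolds

open Cobordism FourManifolds.Flow

universe u

variable {n : ℕ} {W : Type u} [TopologicalSpace W] [T2Space W] [SecondCountableTopology W]
  [CompactSpace W] [ChartedSpace (EuclideanHalfSpace (n + 1)) W] [IsManifold (𝓡∂ (n + 1)) ∞ W]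

/-! ### Reference data and level transports of a pair -/

namespace BasinPair

variable {g : W → ℝ} {ξA ξB : Π x : W, TangentSpace (𝓡∂ (n + 1)) x} (P : BasinPair g ξA ξB)

/-- **Reference data for a level transport** from `ξ_A` to `ξ_B`: a reference level `ℓ₀`
(above the minimum, below `hi`), an open `U` cutting a piece out of that level, an open set
`I₀` of served levels, and a reference map `Φ` sending the piece into the level `ℓ₀`, to
non-critical points, smoothly, such that the `ξ_B`-trajectories of the images meet every level
of `I₀`. [cite: MilnorHCobordism1965, Thm. 4.1 (PDF p. 22)] -/
structure RefData where
  /-- the reference level -/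
  ℓ₀ : ℝ
  /-- the reference level lies above the minimum and below `hi` -/
  ℓ₀_mem : ℓ₀ ∈ Ioo (g P.A.p₀) P.A.hi
  /-- the open set cutting out the reference piece of the level -/
  U : Set W
  /-- `U` is open -/
  isOpen_U : IsOpen U
  /-- the served levels -/
  I₀ : Set ℝ
  /-- the served levels form an open set -/
  isOpen_I₀ : IsOpen I₀
  /-- the served levels lie above the minimum and below `hi` -/
  I₀_subset : I₀ ⊆ Ioo (g P.A.p₀) P.A.hi
  /-- the reference map -/
  Φ : W → W
  /-- `Φ` keeps the reference piece on the level -/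
  apply_Φ : ∀ w ∈ U, g w = ℓ₀ → g (Φ w) = ℓ₀
  /-- the `ξ_B`-trajectories of the images meet the served levels -/
  hits_Φ : ∀ w ∈ U, g w = ℓ₀ → ∀ ℓ ∈ I₀, Hits P.B.θ g ℓ (Φ w)
  /-- the images are non-critical -/
  reg_Φ : ∀ w ∈ U, g w = ℓ₀ → ¬ IsMCriticalPt (𝓡∂ (n + 1)) g (Φ w)
  /-- `Φ` is smooth at the reference piece -/
  contMDiffAt_Φ : ∀ w ∈ U, g w = ℓ₀ → ContMDiffAt (𝓡∂ (n + 1)) (𝓡∂ (n + 1)) ∞ Φ w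

namespace RefData

variable {P} (R : P.RefData)

/-- The reference level lies in the open slab of `A`. [folklore] -/
theorem ℓ₀_mem_Ioo_A : R.ℓ₀ ∈ Ioo P.A.lo P.A.hi := P.A.Ioo_subset_Ioo_lo R.ℓ₀_mem

/-- The reference level lies in the open slab of `B`. [folklore] -/
theorem ℓ₀_mem_Ioo_B : R.ℓ₀ ∈ Ioo P.B.lo P.B.hi := by
  rw [P.lo_eq, P.hi_eq]; exact R.ℓ₀_mem_Ioo_A

/-- Served levels lie in the open slab of `A`. [folklore] -/
theorem mem_Ioo_A {ℓ : ℝ} (h : ℓ ∈ R.I₀) : ℓ ∈ Ioo P.A.lo P.A.hi := P.A.Ioo_subset_Ioo_lo (R.I₀_subset h)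

/-- Served levels lie in the open slab of `B`. [folklore] -/
theorem mem_Ioo_B {ℓ : ℝ} (h : ℓ ∈ R.I₀) : ℓ ∈ Ioo P.B.lo P.B.hi := by
  rw [P.lo_eq, P.hi_eq]; exact R.mem_Ioo_A h

/-- **The domain of the level transport**: served level, non-critical, the `ξ_A`-trajectory
meets the reference level inside `U`. [cite: MilnorHCobordism1965, Thm. 4.1 (PDF p. 22)] -/
def dom : Set W :=
  {x | g x ∈ R.I₀ ∧ ¬ IsMCriticalPt (𝓡∂ (n + 1)) g x ∧ Hits P.A.θ g R.ℓ₀ x ∧ levelProj P.A.θ g R.ℓ₀ x ∈ R.U}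

/-- Membership in the domain. [folklore] -/
theorem mem_dom_iff (x : W) : x ∈ R.dom ↔
    g x ∈ R.I₀ ∧ ¬ IsMCriticalPt (𝓡∂ (n + 1)) g x ∧ Hits P.A.θ g R.ℓ₀ x ∧ levelProj P.A.θ g R.ℓ₀ x ∈ R.U :=
  Iff.rfl

/-- **The reference point** of `x`: the point of its `ξ_A`-trajectory on the reference level. [cite: MilnorHCobordism1965, Thm. 4.1 (PDF p. 22)] -/
def ref (x : W) : W := levelProj P.A.θ g R.ℓ₀ x

/-- `ref`, unfolded. [folklore] -/
theorem ref_def (x : W) : R.ref x = levelProj P.A.θ g R.ℓ₀ x := rfl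

/-- **The level transport**: the point of level `g x` on the `ξ_B`-trajectory of `Φ` of the
reference point. [cite: MilnorHCobordism1965, Thm. 4.1 (PDF p. 22)] [cite: GriffithsHB1964Handlebody, §§3–6] -/
def LT (x : W) : W := levelProj P.B.θ g (g x) (R.Φ (R.ref x))

/-- `LT`, unfolded. [folklore] -/
theorem LT_def (x : W) : R.LT x = levelProj P.B.θ g (g x) (R.Φ (R.ref x)) := rfl

variable {R} {x : W}

/-- The reference point lies on the reference level. [folklore] -/
theorem apply_ref (hx : x ∈ R.dom) : g (R.ref x) = R.ℓ₀ := apply_hittingTime hx.2.2.1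

/-- The reference point lies in `U`. [folklore] -/
theorem ref_mem_U (hx : x ∈ R.dom) : R.ref x ∈ R.U := hx.2.2.2

/-- The reference point is non-critical. [folklore] -/
theorem not_isMCriticalPt_ref (hx : x ∈ R.dom) : ¬ IsMCriticalPt (𝓡∂ (n + 1)) g (R.ref x) :=
  P.A.not_isMCriticalPt_levelProj hx.2.1 _

/-- `Φ (ref x)` lies on the reference level. [folklore] -/
theorem apply_Φ_ref (hx : x ∈ R.dom) : g (R.Φ (R.ref x)) = R.ℓ₀ := R.apply_Φ _ (ref_mem_U hx) (apply_ref hx)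

/-- `Φ (ref x)` is non-critical. [folklore] -/
theorem not_isMCriticalPt_Φ_ref (hx : x ∈ R.dom) : ¬ IsMCriticalPt (𝓡∂ (n + 1)) g (R.Φ (R.ref x)) :=
  R.reg_Φ _ (ref_mem_U hx) (apply_ref hx)

/-- The `ξ_B`-trajectory of `Φ (ref x)` meets every served level. [folklore] -/
theorem hits_Φ_ref (hx : x ∈ R.dom) {ℓ : ℝ} (hℓ : ℓ ∈ R.I₀) : Hits P.B.θ g ℓ (R.Φ (R.ref x)) :=
  R.hits_Φ _ (ref_mem_U hx) (apply_ref hx) ℓ hℓ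

/-- **The level transport preserves `g`.** [cite: GriffithsHB1964Handlebody, §§3–6] -/
theorem apply_LT (hx : x ∈ R.dom) : g (R.LT x) = g x := apply_hittingTime (hits_Φ_ref hx hx.1)

/-- The level transport lands at non-critical points. [folklore] -/
theorem not_isMCriticalPt_LT (hx : x ∈ R.dom) : ¬ IsMCriticalPt (𝓡∂ (n + 1)) g (R.LT x) :=
  P.B.not_isMCriticalPt_levelProj (not_isMCriticalPt_Φ_ref hx) _

/-- The transported point meets every served level (it lies on the trajectory of `Φ (ref x)`). [folklore] -/
theorem hits_LT (hx : x ∈ R.dom) {ℓ : ℝ} (hℓ : ℓ ∈ R.I₀) : Hits P.B.θ g ℓ (R.LT x) := by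
  rw [LT_def, P.B.hits_levelProj_iff]; exact hits_Φ_ref hx hℓ

/-- **The level point at the reference level of the transported point is `Φ (ref x)`.** [folklore] -/
theorem levelProj_LT_ℓ₀ (hx : x ∈ R.dom) : levelProj P.B.θ g R.ℓ₀ (R.LT x) = R.Φ (R.ref x) := by
  rw [LT_def, P.B.levelProj_levelProj (not_isMCriticalPt_Φ_ref hx) _ (Ioo_subset_Icc_self R.ℓ₀_mem_Ioo_B)
    (hits_of_apply_eq (P.B.θ_zero _) (apply_Φ_ref hx)),
    P.B.levelProj_eq_self (not_isMCriticalPt_Φ_ref hx) (Ioo_subset_Icc_self R.ℓ₀_mem_Ioo_B) (apply_Φ_ref hx)]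

/-- Level points of the transported point at served levels. [folklore] -/
theorem levelProj_LT (hx : x ∈ R.dom) {ℓ : ℝ} (hℓ : ℓ ∈ R.I₀) :
    levelProj P.B.θ g ℓ (R.LT x) = levelProj P.B.θ g ℓ (R.Φ (R.ref x)) :=
  P.B.levelProj_levelProj (not_isMCriticalPt_Φ_ref hx) _ (Ioo_subset_Icc_self (R.mem_Ioo_B hℓ)) (hits_Φ_ref hx hℓ)

/-! #### Openness and invariance of the domain -/

variable (R) in
/-- **The domain is open.** [cite: MilnorHCobordism1965, proof of Thm. 5.4, Assertion 4 (PDF p. 29)] -/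
theorem isOpen_dom : IsOpen R.dom := by
  have hgc : Continuous g := P.A.isMorseFunction.isMorse.contMDiff.continuous
  rw [isOpen_iff_mem_nhds]
  intro x hx
  have hslab : g x ∈ Icc P.A.lo P.A.hi := Ioo_subset_Icc_self (R.mem_Ioo_A hx.1)
  have h1 : {z : W | g z ∈ R.I₀} ∈ 𝓝 x := hgc.continuousAt.preimage_mem_nhds (R.isOpen_I₀.mem_nhds hx.1)
  have h2 : {z : W | ¬ IsMCriticalPt (𝓡∂ (n + 1)) g z} ∈ 𝓝 x :=
    P.A.slabFlow'.isOpen_setOf_not_isMCriticalPt.mem_nhds hx.2.1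
  have h3 : {z : W | Hits P.A.θ g R.ℓ₀ z} ∈ 𝓝 x := P.A.hits_mem_nhds' hslab hx.2.1 R.ℓ₀_mem_Ioo_A hx.2.2.1
  have h4 : {z : W | levelProj P.A.θ g R.ℓ₀ z ∈ R.U} ∈ 𝓝 x :=
    (P.A.contMDiffAt_levelProj hslab hx.2.1 R.ℓ₀_mem_Ioo_A hx.2.2.1).continuousAt.preimage_mem_nhds
      (R.isOpen_U.mem_nhds hx.2.2.2)
  filter_upwards [h1, h2, h3, h4] with z hz1 hz2 hz3 hz4
  exact ⟨hz1, hz2, hz3, hz4⟩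

/-- The reference point is constant along `ξ_A`-trajectories. [folklore] -/
theorem ref_θ (hx : x ∈ R.dom) (t : ℝ) : R.ref (P.A.θ (t, x)) = R.ref x :=
  P.A.levelProj_θ hx.2.1 (Ioo_subset_Icc_self R.ℓ₀_mem_Ioo_A) hx.2.2.1 t

/-- **Points of the `ξ_A`-trajectory at served levels stay in the domain.** [folklore] -/
theorem θ_mem_dom (hx : x ∈ R.dom) {t : ℝ} (ht : g (P.A.θ (t, x)) ∈ R.I₀) : P.A.θ (t, x) ∈ R.dom := by
  refine ⟨ht, (P.A.isMCriticalPt_θ_iff t x).not.2 hx.2.1, (P.A.hits_θ_iff t x _).2 hx.2.2.1, ?_⟩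
  have h := ref_θ hx t
  rw [ref_def, ref_def] at h
  rw [h]; exact hx.2.2.2

/-- Level points of domain points at served levels stay in the domain. [folklore] -/
theorem levelProj_mem_dom (hx : x ∈ R.dom) {ℓ : ℝ} (hℓ : ℓ ∈ R.I₀) (hh : Hits P.A.θ g ℓ x) :
    levelProj P.A.θ g ℓ x ∈ R.dom := by
  have h := θ_mem_dom hx (t := hittingTime P.A.θ g ℓ x) (by rw [apply_hittingTime hh]; exact hℓ)
  exact h

/-- **Equivariance along the trajectories**: the transport of the level point of `x` at a served
level `ℓ` is the level point at `ℓ` of the transport of `x`. [cite: MilnorHCobordism1965, Thm. 4.1 (PDF p. 22)] -/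
theorem LT_levelProj (hx : x ∈ R.dom) {ℓ : ℝ} (hℓ : ℓ ∈ R.I₀) (hh : Hits P.A.θ g ℓ x) :
    R.LT (levelProj P.A.θ g ℓ x) = levelProj P.B.θ g ℓ (R.LT x) := by
  have h1 : R.ref (levelProj P.A.θ g ℓ x) = R.ref x := by rw [levelProj_apply]; exact ref_θ hx _
  rw [LT_def, h1, show g (levelProj P.A.θ g ℓ x) = ℓ from apply_hittingTime hh, levelProj_LT hx hℓ]

/-- The transport along a `ξ_A`-trajectory, in terms of the common reference point. [folklore] -/
theorem LT_θ (hx : x ∈ R.dom) (t : ℝ) :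
    R.LT (P.A.θ (t, x)) = levelProj P.B.θ g (g (P.A.θ (t, x))) (R.Φ (R.ref x)) := by
  rw [LT_def, ref_θ hx]

/-! #### Smoothness -/

/-- The reference point is smooth on the domain. [cite: MilnorHCobordism1965, proof of Thm. 5.4, Assertion 4 (PDF p. 29)] -/
theorem contMDiffAt_ref (hx : x ∈ R.dom) : ContMDiffAt (𝓡∂ (n + 1)) (𝓡∂ (n + 1)) ∞ R.ref x :=
  P.A.contMDiffAt_levelProj (Ioo_subset_Icc_self (R.mem_Ioo_A hx.1)) hx.2.1 R.ℓ₀_mem_Ioo_A hx.2.2.1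

/-- **The level transport is smooth on its domain.** [cite: MilnorHCobordism1965, Thm. 4.1, proof of Thm. 5.4 Assertion 4 (PDF pp. 22, 29)] -/
theorem contMDiffAt_LT (hx : x ∈ R.dom) : ContMDiffAt (𝓡∂ (n + 1)) (𝓡∂ (n + 1)) ∞ R.LT x := by
  set w₁ : W := R.Φ (R.ref x) with hw₁
  have hout : ContMDiffAt ((𝓡∂ (n + 1)).prod 𝓘(ℝ, ℝ)) (𝓡∂ (n + 1)) ∞
      (fun p : W × ℝ => levelProj P.B.θ g p.2 p.1) (w₁, g x) :=
    P.B.contMDiffAt_levelProj_prod (by rw [apply_Φ_ref hx]; exact Ioo_subset_Icc_self R.ℓ₀_mem_Ioo_B)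
      (not_isMCriticalPt_Φ_ref hx) (R.mem_Ioo_B hx.1) (hits_Φ_ref hx hx.1)
  have hin : ContMDiffAt (𝓡∂ (n + 1)) ((𝓡∂ (n + 1)).prod 𝓘(ℝ, ℝ)) ∞ (fun z : W => (R.Φ (R.ref z), g z)) x := by
    refine ContMDiffAt.prodMk ?_ P.A.isMorseFunction.isMorse.contMDiff.contMDiffAt
    exact (R.contMDiffAt_Φ _ (ref_mem_U hx) (apply_ref hx)).comp x (contMDiffAt_ref hx)
  have key : ContMDiffAt (𝓡∂ (n + 1)) (𝓡∂ (n + 1)) ∞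
      ((fun p : W × ℝ => levelProj P.B.θ g p.2 p.1) ∘ fun z : W => (R.Φ (R.ref z), g z)) x := hout.comp x hin
  exact key

/-! #### Comparing two level transports -/

/-- **A level transport is determined by the `ξ_B`-trajectory of its reference image**: if `y`
lies on the `ξ_B`-trajectory of `Φ (ref x)` and has the level of `x`, then `LT x = y`. [cite: MilnorHCobordism1965, Thm. 4.1 (PDF p. 22)] -/
theorem LT_eq_of_exists_θ (hx : x ∈ R.dom) {y : W} (hy : ∃ t, P.B.θ (t, R.Φ (R.ref x)) = y)
    (hgy : g y = g x) : R.LT x = y := by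
  obtain ⟨t, rfl⟩ := hy
  exact P.B.levelProj_eq_θ_of_apply_eq (not_isMCriticalPt_Φ_ref hx) (Ioo_subset_Icc_self (R.mem_Ioo_B hx.1)) hgy

/-- **Two reference data give the same transport at a common point of their domains as soon as
their reference images lie on a common `ξ_B`-trajectory.** [cite: MilnorHCobordism1965, Thm. 4.1 (PDF p. 22)] -/
theorem LT_eq_LT_of_exists_θ {R₁ R₂ : P.RefData} (hx₁ : x ∈ R₁.dom) (hx₂ : x ∈ R₂.dom)
    (h : ∃ t, P.B.θ (t, R₁.Φ (R₁.ref x)) = R₂.Φ (R₂.ref x)) : R₁.LT x = R₂.LT x := by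
  obtain ⟨t, ht⟩ := h
  have h1 : R₂.LT x = levelProj P.B.θ g (g x) (P.B.θ (t, R₁.Φ (R₁.ref x))) := by rw [ht]; rfl
  rw [h1, P.B.levelProj_θ (not_isMCriticalPt_Φ_ref hx₁) (Ioo_subset_Icc_self (R₁.mem_Ioo_B hx₁.1))
    (hits_Φ_ref hx₁ hx₁.1)]
  have _ := hx₂
  rfl

/-- The criterion in terms of level points: the reference images agree after projecting the
first to the reference level of the second. [cite: MilnorHCobordism1965, Thm. 4.1 (PDF p. 22)] -/
theorem LT_eq_LT_of_levelProj_eq {R₁ R₂ : P.RefData} (hx₁ : x ∈ R₁.dom) (hx₂ : x ∈ R₂.dom)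
    (h : levelProj P.B.θ g R₂.ℓ₀ (R₁.Φ (R₁.ref x)) = R₂.Φ (R₂.ref x)) : R₁.LT x = R₂.LT x :=
  LT_eq_LT_of_exists_θ hx₁ hx₂ ⟨_, h⟩

/-! #### Inverting a level transport by the swapped pair -/

/-- **Reference data for the swapped pair inverting `Φ` invert the level transport**, and the
transported point lies in their domain. [cite: GriffithsHB1964Handlebody, §§3–6] -/
theorem LT_LT_of_inverse (R' : P.swap.RefData) (hℓ : R'.ℓ₀ = R.ℓ₀)
    (hU : ∀ w ∈ R.U, g w = R.ℓ₀ → R.Φ w ∈ R'.U) (hinv : ∀ w ∈ R.U, g w = R.ℓ₀ → R'.Φ (R.Φ w) = w)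
    (hx : x ∈ R.dom) (hI : g x ∈ R'.I₀) : R.LT x ∈ R'.dom ∧ R'.LT (R.LT x) = x := by
  have hrefy : R'.ref (R.LT x) = R.Φ (R.ref x) := by
    rw [ref_def, hℓ]; exact levelProj_LT_ℓ₀ hx
  have hhit : Hits P.B.θ g R'.ℓ₀ (R.LT x) := by
    rw [hℓ, LT_def, P.B.hits_levelProj_iff]
    exact hits_of_apply_eq (P.B.θ_zero _) (apply_Φ_ref hx)
  have hmem : R.LT x ∈ R'.dom := by
    refine ⟨by rw [apply_LT hx]; exact hI, not_isMCriticalPt_LT hx, hhit, ?_⟩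
    have h := hrefy; rw [ref_def] at h
    show levelProj P.swap.A.θ g R'.ℓ₀ (R.LT x) ∈ R'.U
    rw [h]
    exact hU _ (ref_mem_U hx) (apply_ref hx)
  refine ⟨hmem, ?_⟩
  rw [LT_def, hrefy, hinv _ (ref_mem_U hx) (apply_ref hx), apply_LT hx, swap_B, ref_def]
  -- the level point, at level `g x`, of the reference point of `x` is `x`
  have h1 : levelProj P.A.θ g (g x) (levelProj P.A.θ g R.ℓ₀ x) = levelProj P.A.θ g (g x) x :=
    P.A.levelProj_levelProj hx.2.1 _ (Ioo_subset_Icc_self (R.mem_Ioo_A hx.1)) (hits_of_apply_eq (P.A.θ_zero x) rfl)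
  rw [h1]
  exact P.A.levelProj_eq_self hx.2.1 (Ioo_subset_Icc_self (R.mem_Ioo_A hx.1)) rfl

end RefData

/-! ### The level conjugation `conj` is a level transport -/

section Conj

variable [Nonempty (BoundaryManifold.boundaryData n W).carrier]

/-- **The reference data of the level conjugation** `BasinPairConj.conj χ`: reference level
`L`, reference piece `L ∩ basin_A`, all levels `(g p₀, hi)`, reference map the transport of `χ`. [cite: GriffithsHB1964Handlebody, §§3–6] -/
def refL (χ : (𝓡∂ (n + 1)).boundary W → (𝓡∂ (n + 1)).boundary W) (hχs : ContMDiff (𝓡 n) (𝓡 n) ∞ χ)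
    (hχ : ∀ y, χ y ∈ P.B.traces ↔ y ∈ P.A.traces) : P.RefData where
  ℓ₀ := P.A.L
  ℓ₀_mem := ⟨(P.A.crit_lt _ P.A.isMCriticalPt_p₀).trans P.A.one_sub_a'_lt_L, P.A.L_lt_hi⟩
  U := P.A.basin
  isOpen_U := P.A.isOpen_basin
  I₀ := Ioo (g P.A.p₀) P.A.hi
  isOpen_I₀ := isOpen_Ioo
  I₀_subset := Subset.rfl
  Φ := P.transportAB χ
  apply_Φ w _ _ := P.apply_transportAB χ w
  hits_Φ w hw hwL ℓ hℓ := P.B.hits_of_mem_basin_of_apply_eq_L (P.transportAB_mem_basin hχ hw hwL)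
    (by rw [P.apply_transportAB, P.L_eq]) (by rw [P.apply_p₀_eq, P.hi_eq]; exact hℓ)
  reg_Φ w _ _ := P.B.not_isMCriticalPt_of_eq_L (by rw [P.apply_transportAB, P.L_eq])
  contMDiffAt_Φ w _ hwL := P.contMDiffAt_transportAB hχs (P.A.depth_lt_of_apply_eq_L hwL)

/-- **`conj χ` is the level transport of `refL χ`** (definitionally). [folklore] -/
theorem conj_eq_LT {χ : (𝓡∂ (n + 1)).boundary W → (𝓡∂ (n + 1)).boundary W} (hχs : ContMDiff (𝓡 n) (𝓡 n) ∞ χ)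
    (hχ : ∀ y, χ y ∈ P.B.traces ↔ y ∈ P.A.traces) (x : W) : P.conj χ x = (P.refL χ hχs hχ).LT x := rfl

/-- **`A.dom` lies in the domain of `refL χ`.** [folklore] -/
theorem dom_subset_dom_refL {χ : (𝓡∂ (n + 1)).boundary W → (𝓡∂ (n + 1)).boundary W} (hχs : ContMDiff (𝓡 n) (𝓡 n) ∞ χ)
    (hχ : ∀ y, χ y ∈ P.B.traces ↔ y ∈ P.A.traces) : P.A.dom ⊆ (P.refL χ hχs hχ).dom := fun _ hx =>
  ⟨BasinSetting.apply_mem_Ioo_of_mem_dom hx,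
    P.A.not_isMCriticalPt_of_mem_basin (BasinSetting.mem_basin_of_mem_dom hx) (BasinSetting.ne_p₀_of_mem_dom hx)
      hx.1.le,
    hx.2.1, hx.2.2⟩

end Conj

end BasinPair

end Literature.Topology.FourManifolds
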